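import Summits.QuantumAdvantage.QuantumAdvantage.Theorems.SymplecticPurityGraphStateSpectrum

/-!
# The NAF guard, transported (stub `stub_dlogSignedRepGuard` of item stmt-QuantumAdvantage-10732)

The crux `DlogGraphFlat` (line `Sketch`) carries a guard hypothesis: every signed-binary
representation `c : Fin (n + 1) → {0, 1, −1}` of `p − 1` (`Σ_{i ≤ n} cᵢ 2ⁱ = p − 1`) has weight
at least `n / 8`, stated as `n ≤ 8 · #{i : cᵢ ≠ 0}`. The differential-count assembly of the crux
meets signed-digit relations on `n` digits `ε : Fin n → {0, 1, −1}` of four shapes,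
`Σ εᵢ 2ⁱ = ±(p − 1)` and `2 · Σ εᵢ 2ⁱ = ±(p − 1)`; this file transports the guard to them.

Proof. `Σ εᵢ 2ⁱ = p − 1`: append a zero top digit (`Fin.snoc ε 0`), value and weight unchanged.
`2 · Σ εᵢ 2ⁱ = p − 1`: prepend a zero bottom digit (`Fin.cons 0 ε`), the value doubles and the
weight is unchanged. The two negative shapes reduce to these applied to `−ε`, which has the same
weight and digits in `{0, 1, −1}`. In each case the guard applies to the extended digit string.
-/

set_option linter.dupNamespace false -- D-0017: single-problem summit ⇒ `QuantumAdvantage.QuantumAdvantage` by design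

namespace Summit.QuantumAdvantage.QuantumAdvantage.Theorems.SymplecticPurity

open Finset

/-! ### Negating a signed-digit string -/

/-- The digit alphabet `{0, 1, −1}` is closed under negation. [folklore] -/
theorem signedDigits_neg {n : ℕ} {ε : Fin n → ℤ} (hε : ∀ i, ε i = 0 ∨ ε i = 1 ∨ ε i = -1) :
    ∀ i, (-ε) i = 0 ∨ (-ε) i = 1 ∨ (-ε) i = -1 := by
  intro i
  rcases hε i with h | h | h <;> simp [h]

/-- Negation preserves the weight (number of non-zero digits). [folklore] -/
theorem card_filter_neg_ne_zero {n : ℕ} (ε : Fin n → ℤ) :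
    (univ.filter fun i => (-ε) i ≠ 0).card = (univ.filter fun i => ε i ≠ 0).card := by
  simp only [Pi.neg_apply, ne_eq, neg_eq_zero]

/-- Negation negates the signed-binary value. [folklore] -/
theorem sum_neg_mul_two_pow {n : ℕ} (ε : Fin n → ℤ) :
    ∑ i, (-ε) i * 2 ^ (i : ℕ) = -∑ i, ε i * 2 ^ (i : ℕ) := by
  simp only [Pi.neg_apply, neg_mul, sum_neg_distrib]

/-! ### Appending a zero top digit -/

/-- Appending a zero top digit keeps the digits in `{0, 1, −1}`. [folklore] -/
theorem signedDigits_snoc_zero {n : ℕ} {ε : Fin n → ℤ}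
    (hε : ∀ i, ε i = 0 ∨ ε i = 1 ∨ ε i = -1) :
    ∀ i, (Fin.snoc ε 0 : Fin (n + 1) → ℤ) i = 0 ∨ (Fin.snoc ε 0 : Fin (n + 1) → ℤ) i = 1 ∨
      (Fin.snoc ε 0 : Fin (n + 1) → ℤ) i = -1 := by
  intro i
  cases i using Fin.lastCases with
  | last => simp
  | cast j => simpa using hε j

/-- Appending a zero top digit keeps the signed-binary value. [folklore] -/
theorem sum_snoc_zero_mul_two_pow {n : ℕ} (ε : Fin n → ℤ) :
    ∑ i : Fin (n + 1), (Fin.snoc ε 0 : Fin (n + 1) → ℤ) i * 2 ^ (i : ℕ) =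
      ∑ i, ε i * 2 ^ (i : ℕ) := by
  rw [Fin.sum_univ_castSucc]
  simp only [Fin.snoc_castSucc, Fin.snoc_last, Fin.val_castSucc, zero_mul, add_zero]

/-- Appending a zero top digit keeps the weight. [folklore] -/
theorem card_filter_snoc_zero_ne_zero {n : ℕ} (ε : Fin n → ℤ) :
    (univ.filter fun i => (Fin.snoc ε 0 : Fin (n + 1) → ℤ) i ≠ 0).card =
      (univ.filter fun i => ε i ≠ 0).card := by
  rw [card_filter, card_filter, Fin.sum_univ_castSucc]
  simp only [Fin.snoc_castSucc, Fin.snoc_last, ne_eq, not_true_eq_false, if_false, add_zero]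

/-! ### Prepending a zero bottom digit -/

/-- Prepending a zero bottom digit keeps the digits in `{0, 1, −1}`. [folklore] -/
theorem signedDigits_cons_zero {n : ℕ} {ε : Fin n → ℤ}
    (hε : ∀ i, ε i = 0 ∨ ε i = 1 ∨ ε i = -1) :
    ∀ i, (Fin.cons 0 ε : Fin (n + 1) → ℤ) i = 0 ∨ (Fin.cons 0 ε : Fin (n + 1) → ℤ) i = 1 ∨
      (Fin.cons 0 ε : Fin (n + 1) → ℤ) i = -1 := by
  intro i
  cases i using Fin.cases with
  | zero => simp
  | succ j => simpa using hε j

/-- Prepending a zero bottom digit doubles the signed-binary value. [folklore] -/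
theorem sum_cons_zero_mul_two_pow {n : ℕ} (ε : Fin n → ℤ) :
    ∑ i : Fin (n + 1), (Fin.cons 0 ε : Fin (n + 1) → ℤ) i * 2 ^ (i : ℕ) =
      2 * ∑ i, ε i * 2 ^ (i : ℕ) := by
  rw [Fin.sum_univ_succ, mul_sum]
  simp only [Fin.cons_zero, Fin.cons_succ, Fin.val_succ, pow_succ, zero_mul, zero_add]
  exact sum_congr rfl fun i _ => by ring

/-- Prepending a zero bottom digit keeps the weight. [folklore] -/
theorem card_filter_cons_zero_ne_zero {n : ℕ} (ε : Fin n → ℤ) :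
    (univ.filter fun i => (Fin.cons 0 ε : Fin (n + 1) → ℤ) i ≠ 0).card =
      (univ.filter fun i => ε i ≠ 0).card := by
  rw [card_filter, card_filter, Fin.sum_univ_succ]
  simp only [Fin.cons_zero, Fin.cons_succ, ne_eq, not_true_eq_false, if_false, zero_add]

/-! ### The transported guard -/

/-- **The NAF guard, transported.** If every signed-binary representation of `p − 1` on the
digits `0 … n` has weight `≥ n/8` (`n ≤ 8 · #{i : cᵢ ≠ 0}`), then so does every signed-binary
representation `ε` on the digits `0 … n−1` of `±(p − 1)` (extend by `εₙ = 0`, negate) and of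
`±(p − 1)/2` (shift up by one digit). -/
theorem stub_dlogSignedRepGuard : ∀ (n p : ℕ),
    (∀ c : Fin (n + 1) → ℤ, (∀ i, c i = 0 ∨ c i = 1 ∨ c i = -1) →
      ∑ i, c i * 2 ^ (i : ℕ) = (p : ℤ) - 1 → n ≤ 8 * (Finset.univ.filter fun i => c i ≠ 0).card) →
    ∀ ε : Fin n → ℤ, (∀ i, ε i = 0 ∨ ε i = 1 ∨ ε i = -1) →
    (∑ i, ε i * 2 ^ (i : ℕ) = (p : ℤ) - 1 ∨ ∑ i, ε i * 2 ^ (i : ℕ) = -((p : ℤ) - 1) ∨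
      2 * ∑ i, ε i * 2 ^ (i : ℕ) = (p : ℤ) - 1 ∨ 2 * ∑ i, ε i * 2 ^ (i : ℕ) = -((p : ℤ) - 1)) →
    n ≤ 8 * (Finset.univ.filter fun i => ε i ≠ 0).card := by
  intro n p hguard
  -- shape `Σ εᵢ 2ⁱ = p − 1`: append a zero top digit
  have top : ∀ ε : Fin n → ℤ, (∀ i, ε i = 0 ∨ ε i = 1 ∨ ε i = -1) →
      ∑ i, ε i * 2 ^ (i : ℕ) = (p : ℤ) - 1 → n ≤ 8 * (univ.filter fun i => ε i ≠ 0).card := by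
    intro ε hε hsum
    have h := hguard (Fin.snoc ε 0) (signedDigits_snoc_zero hε)
      (by rw [sum_snoc_zero_mul_two_pow, hsum])
    rwa [card_filter_snoc_zero_ne_zero] at h
  -- shape `2 · Σ εᵢ 2ⁱ = p − 1`: prepend a zero bottom digit
  have bot : ∀ ε : Fin n → ℤ, (∀ i, ε i = 0 ∨ ε i = 1 ∨ ε i = -1) →
      2 * ∑ i, ε i * 2 ^ (i : ℕ) = (p : ℤ) - 1 → n ≤ 8 * (univ.filter fun i => ε i ≠ 0).card := by
    intro ε hε hsum
    have h := hguard (Fin.cons 0 ε) (signedDigits_cons_zero hε)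
      (by rw [sum_cons_zero_mul_two_pow, hsum])
    rwa [card_filter_cons_zero_ne_zero] at h
  intro ε hε hcases
  rcases hcases with h | h | h | h
  · exact top ε hε h
  · have h' := top (-ε) (signedDigits_neg hε) (by rw [sum_neg_mul_two_pow, h, neg_neg])
    rwa [card_filter_neg_ne_zero] at h'
  · exact bot ε hε h
  · have h' := bot (-ε) (signedDigits_neg hε)
      (by rw [sum_neg_mul_two_pow, mul_neg, h, neg_neg])
    rwa [card_filter_neg_ne_zero] at h'

end Summit.QuantumAdvantage.QuantumAdvantage.Theorems.SymplecticPurity
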